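import Literature.NumberTheory.Automorphic.HeckeEulerFactorisationGL2ArchGamma
import Literature.NumberTheory.Automorphic.KirillovShapeMellinGL2
import Literature.NumberTheory.Automorphic.StandardLTheoryGL2GammaPackage
import HarnessLib

/-!
# The standard `L`-theory of `GL₂` from two archimedean GAMMA PRODUCTS: the entry point `(A_GP)`
# (Jacquet–Langlands (1970), proof of Thm. 11.1, p. 173; Thm. 5.15, Thm. 6.4)

Topic `Literature/NumberTheory/Automorphic`. Theorems only (no definition, no named fact, no instance).

A SIXTH entry point to the accepted reduction of the standard `L`-theory of cuspidal `GL₂`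
(`JacquetLanglands1970_standardLTheoryGL2`), the Galois-twisted Hecke theory
(`JacquetLanglands1970_twistedHeckeTheoryGL2`) and Gelbart's Prop. 4.1
(`frobSatakeCompatibleAt_of_isPiOfArtinRep_of_isUnramifiedAt`) to an archimedean statement about ONE
`K_∞`-finite Gårding vector, phrased with the predicate `IsGammaProduct` of `KirillovShapeMellinGL2`
(`IsGammaProduct x₀ f :↔ f(s) = A e^{αs} ∏_j Γ_ℝ(s + a_j) ∏_j Γ_ℂ(s + b_j)` on `re s > x₀`, `A ≠ 0`), i.e.
exactly in the currency produced by `isGammaProduct_mellin_units_of_prod` (the Mellin transform over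
`K_∞ˣ` of a product of real / complex shape functions):

  `(A_GP)`  for every irreducible unitary strongly continuous `τ` of `GL₂(K_∞)` occurring in a cuspidal
  `Π ≤ L²_cusp` (with its central character `ω`, `|ω| = 1`, and a non-zero continuous Whittaker functional
  `ℓ` on the Gårding space, all SUPPLIED to the user) and every Haar measure `μ'` on `K_∞ˣ`, there are a
  `K_∞`-finite Gårding vector `e₀` and abscissae `x₀, x₀'` with

    `IsGammaProduct x₀  (s ↦ ∫ W_{e₀}(diag(u,1)) N(u)^{s-1/2} dμ'(u))` and
    `IsGammaProduct x₀' (s ↦ ∫ ω(u⁻¹) W_{τ(w)e₀}(diag(u,1)) N(u)^{s-1/2} dμ'(u))`,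

  `W_e(diag(u,1)) = kirillovFn hτ ℓ e u`, `w = weylLong 2 K_∞` — Jacquet–Langlands' Thm. 5.15 (ii)–(iv) /
  Thm. 6.4 for the Hecke test vector, both sides, in Kirillov form.

`(A_GP) ⇒ (A_Γ)` (`archKirillovGamma_of_archKirillovGammaProduct`): a Gamma product has an entire
reciprocal `Γi(s) = A⁻¹ e^{-αs} ∏ Γ_ℝ(s + a_j)⁻¹ ∏ Γ_ℂ(s + b_j)⁻¹` whose zeros lie on the finitely many
horizontal lines `im s = -im a_j, -im b_j` and with `Γi · f = 1` far to the right
(`IsGammaProduct.exists_reciprocal`, from `StandardLTheoryGL2GammaPackage`); no integrability clause is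
needed (`HeckeEulerFactorisationGL2ArchGamma`: `integrable_kirillovFn_mul_norm_cpow`). The three named
facts then follow from `(A_GP)` by the `(A_Γ)` entry points
(`…_of_archKirillovGamma`, `HeckeEulerFactorisationGL2ArchGamma.lean`).

HOW THE ARCHIMEDEAN SIDE CLOSES `(A_GP)` (for the record): with `e₀` a `K_∞`-finite Gårding vector whose
Kirillov function is rigid at every place (`ArchKirillovFactorisationGL2.exists_kirillovFn_eq_const_mul_prod`:
`W_{e₀}(diag(u,1)) = C ∏_w F_w(u_w) ∏_w G_w(u_w)`, `C ≠ 0`) with shape functions whose local Mellin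
transforms are Gamma products (`isGammaProduct_mellin_expShape`, `…_besselShape`, `…_complexBesselShape`),
`isGammaProduct_mellin_units_of_prod μ'` gives the first clause; the same for the vector `τ(w) e₀` and the
function `u ↦ ω(u⁻¹) W_{τ(w)e₀}(diag(u,1))` (`ω` is a continuous unitary character of `K_∞ˣ`, a product
of local characters) gives the second.

## References

* H. Jacquet, R. P. Langlands, *Automorphic Forms on GL(2)*, Lecture Notes in Math. 114, Springer (1970):
  Thm. 5.15 (ii)–(iv) (p. 93), Thm. 6.4 (p. 114), proof of Thm. 11.1 (pp. 171–173), Cor. 11.2.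
  [JacquetLanglands1970]
* S. Gelbart, *Three lectures on the modularity of ρ̄_{E,3} and the Langlands reciprocity conjecture*, in
  Modular Forms and Fermat's Last Theorem, Springer (1997), Prop. 4.1. [Gelbart1997]
-/

noncomputable section

open MeasureTheory Measure NumberField NumberField.InfinitePlace NumberField.mixedEmbedding IsDedekindDomain Set Filter
open scoped MatrixGroups NNReal Topology Classical

namespace Literature.NumberTheory.Automorphic

/-! ### 1. A Gamma product has an entire reciprocal with zeros on finitely many horizontal lines -/

/-- **The reciprocal of a Gamma product.** If `f(s) = A e^{αs} ∏_j Γ_ℝ(s + a_j) ∏_j Γ_ℂ(s + b_j)` on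
`re s > x₀` with `A ≠ 0`, then `Γi(s) = A⁻¹ e^{-αs} ∏_j Γ_ℝ(s + a_j)⁻¹ ∏_j Γ_ℂ(s + b_j)⁻¹` is entire, its
zeros have imaginary part in the finite set `{-im a_j} ∪ {-im b_j}`, and `Γi(s) f(s) = 1` for
`re s > max(x₀, Σ_j |re a_j| + Σ_j |re b_j|)`. [cite: JacquetLanglands1970, proof of Thm. 11.1 (p. 173)] -/
theorem IsGammaProduct.exists_reciprocal {x₀ : ℝ} {f : ℂ → ℂ} (hf : IsGammaProduct x₀ f) :
    ∃ Γi : ℂ → ℂ, Differentiable ℂ Γi ∧ (∃ Y : Set ℝ, Y.Finite ∧ ∀ s, Γi s = 0 → s.im ∈ Y) ∧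
      ∃ x₁ : ℝ, x₀ ≤ x₁ ∧ ∀ s : ℂ, x₁ < s.re → Γi s * f s = 1 := by
  obtain ⟨A, α, d₁, d₂, a, b, hA, hf⟩ := hf
  refine ⟨fun s => A⁻¹ * Complex.exp (-(α * s)) *
      ((∏ j, (Complex.Gammaℝ (s + a j))⁻¹) * ∏ j, (Complex.Gammaℂ (s + b j))⁻¹), ?_, ?_,
    max x₀ ((∑ j, |(a j).re|) + ∑ j, |(b j).re|), le_max_left _ _, fun s hs => ?_⟩
  · exact ((differentiable_const _).mul
      (((differentiable_const α).mul differentiable_id).neg.cexp)).mul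
      (differentiable_inv_archGammaProduct a b)
  · refine ⟨_, finite_zeroOrdinates a b, fun s hs => ?_⟩
    have h0 : A⁻¹ * Complex.exp (-(α * s)) ≠ 0 := mul_ne_zero (inv_ne_zero hA) (Complex.exp_ne_zero _)
    exact inv_archGammaProduct_eq_zero_imp a b ((mul_eq_zero.1 hs).resolve_left h0)
  · have hs₀ : x₀ < s.re := lt_of_le_of_lt (le_max_left _ _) hs
    have hs₁ : (∑ j, |(a j).re|) + ∑ j, |(b j).re| < s.re := lt_of_le_of_lt (le_max_right _ _) hs
    have hG := inv_archGammaProduct_mul_archGammaProduct a b (archGammaProduct_ne_zero_of_lt_re a b hs₁)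
    have hexp : Complex.exp (-(α * s)) * Complex.exp (α * s) = 1 := by
      rw [← Complex.exp_add, neg_add_cancel, Complex.exp_zero]
    rw [hf s hs₀]
    calc A⁻¹ * Complex.exp (-(α * s)) *
            ((∏ j, (Complex.Gammaℝ (s + a j))⁻¹) * ∏ j, (Complex.Gammaℂ (s + b j))⁻¹) *
          (A * Complex.exp (α * s) * ((∏ j, Complex.Gammaℝ (s + a j)) * ∏ j, Complex.Gammaℂ (s + b j)))
        = (A⁻¹ * A) * (Complex.exp (-(α * s)) * Complex.exp (α * s)) *
            (((∏ j, (Complex.Gammaℝ (s + a j))⁻¹) * ∏ j, (Complex.Gammaℂ (s + b j))⁻¹) *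
              ((∏ j, Complex.Gammaℝ (s + a j)) * ∏ j, Complex.Gammaℂ (s + b j))) := by ring
      _ = 1 := by simp only [inv_mul_cancel₀ hA, hexp, hG, mul_one]

/-! ### 2. `(A_GP) ⇒ (A_Γ)` -/

section ArchGammaProduct

-- as in `ArchGardingWhittaker`
set_option backward.isDefEq.respectTransparency false

/-- **`(A_GP) ⇒ (A_Γ)`**: two Gamma products for the Hecke test vector give the Gamma identities of
`integralRepresentation_clean_of_archKirillovGamma` (entire reciprocals with zeros on finitely many
horizontal lines, `Γi · ∫ = 1` and `Γi' · ∫' = 1` on a common right half-plane).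
[cite: JacquetLanglands1970, Thm. 5.15 (ii)–(iv), Thm. 6.4, proof of Thm. 11.1 (p. 173)] -/
theorem archKirillovGamma_of_archKirillovGammaProduct
    (hA : ∀ (K : Type) [Field K] [NumberField K] (hcpt : isCompact_glFiniteIntegralLevel 2 K)
      (μ : Measure (AdelicGroupData.gl 2 K).automorphicQuotient) [(AdelicGroupData.gl 2 K).IsAutomorphicMeasure μ]
      (Pl : CuspidalAutomorphicRepGL 2 K μ)
      (E : Type) [NormedAddCommGroup E] [InnerProductSpace ℂ E] [CompleteSpace E]
      (τ : ContRepresentation ℂ (AutomorphyDatum.gl 2 K hcpt).arch.carrier E) (hτ : τ.IsStronglyContinuous)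
      (_ : τ.IsUnitary) (_ : τ.IsTopIrreducible) (_ : ∃ T ∈ archIntertwiners hcpt τ Pl.1, T ≠ 0)
      (ω : (mixedSpace K)ˣ → ℂ) (_ : ∀ c, ‖ω c‖ = 1)
      (_ : ∀ (c : (mixedSpace K)ˣ) (v : E), τ (toArch hcpt (glDiagonal 2 (mixedSpace K) fun _ => c)) v = ω c • v)
      (ℓ : archGardingSpace hcpt τ →ₗ[ℂ] ℂ) (_ : IsArchContWhittakerFunctional hcpt τ hτ ℓ) (_ : ℓ ≠ 0)
      [MeasurableSpace ((mixedSpace K)ˣ)] [BorelSpace ((mixedSpace K)ˣ)]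
      (μ' : Measure ((mixedSpace K)ˣ)) (_ : IsHaarMeasure μ'),
      ∃ (e₀ : archGardingSpace hcpt τ)
        (_ : FiniteDimensional ℂ (Submodule.span ℂ (Set.range
          fun κ : (AutomorphyDatum.gl 2 K hcpt).arch.maximalCompact =>
            τ (toArch hcpt (κ : GL (Fin 2) (mixedSpace K))) (e₀ : E)))) (x₀ x₀' : ℝ),
        IsGammaProduct x₀ (fun s => ∫ u : (mixedSpace K)ˣ, kirillovFn hτ ℓ e₀ u *
            ((mixedEmbedding.norm ((u : (mixedSpace K)ˣ) : mixedSpace K) : ℝ) : ℂ) ^ (s - 1 / 2) ∂μ') ∧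
        IsGammaProduct x₀' (fun s => ∫ u : (mixedSpace K)ˣ,
            ω u⁻¹ * kirillovFn hτ ℓ (gardingAct hτ (weylLong 2 (mixedSpace K)) e₀) u *
              ((mixedEmbedding.norm ((u : (mixedSpace K)ˣ) : mixedSpace K) : ℝ) : ℂ) ^ (s - 1 / 2) ∂μ'))
    (K : Type) [Field K] [NumberField K] (hcpt : isCompact_glFiniteIntegralLevel 2 K)
    (μ : Measure (AdelicGroupData.gl 2 K).automorphicQuotient) [(AdelicGroupData.gl 2 K).IsAutomorphicMeasure μ]
    (Pl : CuspidalAutomorphicRepGL 2 K μ)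
    (E : Type) [NormedAddCommGroup E] [InnerProductSpace ℂ E] [CompleteSpace E]
    (τ : ContRepresentation ℂ (AutomorphyDatum.gl 2 K hcpt).arch.carrier E) (hτ : τ.IsStronglyContinuous)
    (hτu : τ.IsUnitary) (hτi : τ.IsTopIrreducible) (hex : ∃ T ∈ archIntertwiners hcpt τ Pl.1, T ≠ 0)
    (ω : (mixedSpace K)ˣ → ℂ) (hω1 : ∀ c, ‖ω c‖ = 1)
    (hω : ∀ (c : (mixedSpace K)ˣ) (v : E), τ (toArch hcpt (glDiagonal 2 (mixedSpace K) fun _ => c)) v = ω c • v)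
    (ℓ : archGardingSpace hcpt τ →ₗ[ℂ] ℂ) (hℓ : IsArchContWhittakerFunctional hcpt τ hτ ℓ) (hℓ0 : ℓ ≠ 0)
    [MeasurableSpace ((mixedSpace K)ˣ)] [BorelSpace ((mixedSpace K)ˣ)]
    (μ' : Measure ((mixedSpace K)ˣ)) (hμ' : IsHaarMeasure μ') :
    ∃ (e₀ : archGardingSpace hcpt τ)
      (_ : FiniteDimensional ℂ (Submodule.span ℂ (Set.range
        fun κ : (AutomorphyDatum.gl 2 K hcpt).arch.maximalCompact =>
          τ (toArch hcpt (κ : GL (Fin 2) (mixedSpace K))) (e₀ : E))))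
      (Γi Γi' : ℂ → ℂ) (_ : Differentiable ℂ Γi) (_ : Differentiable ℂ Γi')
      (_ : ∃ Y : Set ℝ, Y.Finite ∧ ∀ s, Γi s = 0 → s.im ∈ Y)
      (_ : ∃ Y : Set ℝ, Y.Finite ∧ ∀ s, Γi' s = 0 → s.im ∈ Y) (x₀ : ℝ),
      ∀ s : ℂ, x₀ < s.re →
        Γi s * ∫ u : (mixedSpace K)ˣ, kirillovFn hτ ℓ e₀ u *
            ((mixedEmbedding.norm ((u : (mixedSpace K)ˣ) : mixedSpace K) : ℝ) : ℂ) ^ (s - 1 / 2) ∂μ' = 1 ∧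
        Γi' s * ∫ u : (mixedSpace K)ˣ,
            ω u⁻¹ * kirillovFn hτ ℓ (gardingAct hτ (weylLong 2 (mixedSpace K)) e₀) u *
              ((mixedEmbedding.norm ((u : (mixedSpace K)ˣ) : mixedSpace K) : ℝ) : ℂ) ^ (s - 1 / 2) ∂μ' = 1 := by
  obtain ⟨e₀, he₀, x₀, x₀', h1, h2⟩ := hA K hcpt μ Pl E τ hτ hτu hτi hex ω hω1 hω ℓ hℓ hℓ0 μ' hμ'
  obtain ⟨Γi, hΓi, hY, x₁, -, hx₁⟩ := h1.exists_reciprocal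
  obtain ⟨Γi', hΓi', hY', x₁', -, hx₁'⟩ := h2.exists_reciprocal
  exact ⟨e₀, he₀, Γi, Γi', hΓi, hΓi', hY, hY', max x₁ x₁', fun s hs =>
    ⟨hx₁ s (lt_of_le_of_lt (le_max_left _ _) hs), hx₁' s (lt_of_le_of_lt (le_max_right _ _) hs)⟩⟩

/-! ### 3. The three named facts from `(A_GP)` -/

/-- **Jacquet–Langlands (1970), Thm. 11.1 / Cor. 11.2 (the named fact `JacquetLanglands1970_standardLTheoryGL2`)
from two archimedean Gamma products `(A_GP)` alone.** [cite: JacquetLanglands1970, Thm. 11.1, Cor. 11.2, Thm. 5.15, Thm. 6.4] -/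
theorem JacquetLanglands1970_standardLTheoryGL2_of_archKirillovGammaProduct
    (hA : ∀ (K : Type) [Field K] [NumberField K] (hcpt : isCompact_glFiniteIntegralLevel 2 K)
      (μ : Measure (AdelicGroupData.gl 2 K).automorphicQuotient) [(AdelicGroupData.gl 2 K).IsAutomorphicMeasure μ]
      (Pl : CuspidalAutomorphicRepGL 2 K μ)
      (E : Type) [NormedAddCommGroup E] [InnerProductSpace ℂ E] [CompleteSpace E]
      (τ : ContRepresentation ℂ (AutomorphyDatum.gl 2 K hcpt).arch.carrier E) (hτ : τ.IsStronglyContinuous)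
      (_ : τ.IsUnitary) (_ : τ.IsTopIrreducible) (_ : ∃ T ∈ archIntertwiners hcpt τ Pl.1, T ≠ 0)
      (ω : (mixedSpace K)ˣ → ℂ) (_ : ∀ c, ‖ω c‖ = 1)
      (_ : ∀ (c : (mixedSpace K)ˣ) (v : E), τ (toArch hcpt (glDiagonal 2 (mixedSpace K) fun _ => c)) v = ω c • v)
      (ℓ : archGardingSpace hcpt τ →ₗ[ℂ] ℂ) (_ : IsArchContWhittakerFunctional hcpt τ hτ ℓ) (_ : ℓ ≠ 0)
      [MeasurableSpace ((mixedSpace K)ˣ)] [BorelSpace ((mixedSpace K)ˣ)]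
      (μ' : Measure ((mixedSpace K)ˣ)) (_ : IsHaarMeasure μ'),
      ∃ (e₀ : archGardingSpace hcpt τ)
        (_ : FiniteDimensional ℂ (Submodule.span ℂ (Set.range
          fun κ : (AutomorphyDatum.gl 2 K hcpt).arch.maximalCompact =>
            τ (toArch hcpt (κ : GL (Fin 2) (mixedSpace K))) (e₀ : E)))) (x₀ x₀' : ℝ),
        IsGammaProduct x₀ (fun s => ∫ u : (mixedSpace K)ˣ, kirillovFn hτ ℓ e₀ u *
            ((mixedEmbedding.norm ((u : (mixedSpace K)ˣ) : mixedSpace K) : ℝ) : ℂ) ^ (s - 1 / 2) ∂μ') ∧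
        IsGammaProduct x₀' (fun s => ∫ u : (mixedSpace K)ˣ,
            ω u⁻¹ * kirillovFn hτ ℓ (gardingAct hτ (weylLong 2 (mixedSpace K)) e₀) u *
              ((mixedEmbedding.norm ((u : (mixedSpace K)ˣ) : mixedSpace K) : ℝ) : ℂ) ^ (s - 1 / 2) ∂μ')) :
    JacquetLanglands1970_standardLTheoryGL2 :=
  JacquetLanglands1970_standardLTheoryGL2_of_archKirillovGamma
    fun K _ _ hcpt μ _ Pl E _ _ _ τ hτ hτu hτi hex ω hω1 hω ℓ hℓ hℓ0 _ _ μ' hμ' =>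
      archKirillovGamma_of_archKirillovGammaProduct hA K hcpt μ Pl E τ hτ hτu hτi hex ω hω1 hω ℓ hℓ hℓ0 μ' hμ'

/-- **Gelbart (1997), Prop. 4.1 at the σ-unramified places (the named fact
`frobSatakeCompatibleAt_of_isPiOfArtinRep_of_isUnramifiedAt`) from two archimedean Gamma products `(A_GP)`
alone.** [cite: Gelbart1997, Prop. 4.1] [cite: JacquetLanglands1970, Thm. 12.2, Thm. 11.1, Thm. 5.15, Thm. 6.4] -/
theorem frobSatakeCompatibleAt_of_isPiOfArtinRep_of_isUnramifiedAt_of_archKirillovGammaProduct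
    (hA : ∀ (K : Type) [Field K] [NumberField K] (hcpt : isCompact_glFiniteIntegralLevel 2 K)
      (μ : Measure (AdelicGroupData.gl 2 K).automorphicQuotient) [(AdelicGroupData.gl 2 K).IsAutomorphicMeasure μ]
      (Pl : CuspidalAutomorphicRepGL 2 K μ)
      (E : Type) [NormedAddCommGroup E] [InnerProductSpace ℂ E] [CompleteSpace E]
      (τ : ContRepresentation ℂ (AutomorphyDatum.gl 2 K hcpt).arch.carrier E) (hτ : τ.IsStronglyContinuous)
      (_ : τ.IsUnitary) (_ : τ.IsTopIrreducible) (_ : ∃ T ∈ archIntertwiners hcpt τ Pl.1, T ≠ 0)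
      (ω : (mixedSpace K)ˣ → ℂ) (_ : ∀ c, ‖ω c‖ = 1)
      (_ : ∀ (c : (mixedSpace K)ˣ) (v : E), τ (toArch hcpt (glDiagonal 2 (mixedSpace K) fun _ => c)) v = ω c • v)
      (ℓ : archGardingSpace hcpt τ →ₗ[ℂ] ℂ) (_ : IsArchContWhittakerFunctional hcpt τ hτ ℓ) (_ : ℓ ≠ 0)
      [MeasurableSpace ((mixedSpace K)ˣ)] [BorelSpace ((mixedSpace K)ˣ)]
      (μ' : Measure ((mixedSpace K)ˣ)) (_ : IsHaarMeasure μ'),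
      ∃ (e₀ : archGardingSpace hcpt τ)
        (_ : FiniteDimensional ℂ (Submodule.span ℂ (Set.range
          fun κ : (AutomorphyDatum.gl 2 K hcpt).arch.maximalCompact =>
            τ (toArch hcpt (κ : GL (Fin 2) (mixedSpace K))) (e₀ : E)))) (x₀ x₀' : ℝ),
        IsGammaProduct x₀ (fun s => ∫ u : (mixedSpace K)ˣ, kirillovFn hτ ℓ e₀ u *
            ((mixedEmbedding.norm ((u : (mixedSpace K)ˣ) : mixedSpace K) : ℝ) : ℂ) ^ (s - 1 / 2) ∂μ') ∧
        IsGammaProduct x₀' (fun s => ∫ u : (mixedSpace K)ˣ,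
            ω u⁻¹ * kirillovFn hτ ℓ (gardingAct hτ (weylLong 2 (mixedSpace K)) e₀) u *
              ((mixedEmbedding.norm ((u : (mixedSpace K)ˣ) : mixedSpace K) : ℝ) : ℂ) ^ (s - 1 / 2) ∂μ')) :
    frobSatakeCompatibleAt_of_isPiOfArtinRep_of_isUnramifiedAt :=
  frobSatakeCompatibleAt_of_isPiOfArtinRep_of_isUnramifiedAt_of_JacquetLanglands1970_standardLTheoryGL2
    (JacquetLanglands1970_standardLTheoryGL2_of_archKirillovGammaProduct hA)

/-- The Galois-twisted Hecke theory `JacquetLanglands1970_twistedHeckeTheoryGL2` and the `π`-unramified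
companion `frobSatakeCompatibleAt_of_isPiOfArtinRep` from two archimedean Gamma products `(A_GP)` alone.
[cite: Gelbart1997, Prop. 4.1] [cite: JacquetLanglands1970, Thm. 11.1, Cor. 11.2, Thm. 5.15, Thm. 6.4] -/
theorem JacquetLanglands1970_twistedHeckeTheoryGL2_and_frobSatakeCompatibleAt_of_archKirillovGammaProduct
    (hA : ∀ (K : Type) [Field K] [NumberField K] (hcpt : isCompact_glFiniteIntegralLevel 2 K)
      (μ : Measure (AdelicGroupData.gl 2 K).automorphicQuotient) [(AdelicGroupData.gl 2 K).IsAutomorphicMeasure μ]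
      (Pl : CuspidalAutomorphicRepGL 2 K μ)
      (E : Type) [NormedAddCommGroup E] [InnerProductSpace ℂ E] [CompleteSpace E]
      (τ : ContRepresentation ℂ (AutomorphyDatum.gl 2 K hcpt).arch.carrier E) (hτ : τ.IsStronglyContinuous)
      (_ : τ.IsUnitary) (_ : τ.IsTopIrreducible) (_ : ∃ T ∈ archIntertwiners hcpt τ Pl.1, T ≠ 0)
      (ω : (mixedSpace K)ˣ → ℂ) (_ : ∀ c, ‖ω c‖ = 1)
      (_ : ∀ (c : (mixedSpace K)ˣ) (v : E), τ (toArch hcpt (glDiagonal 2 (mixedSpace K) fun _ => c)) v = ω c • v)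
      (ℓ : archGardingSpace hcpt τ →ₗ[ℂ] ℂ) (_ : IsArchContWhittakerFunctional hcpt τ hτ ℓ) (_ : ℓ ≠ 0)
      [MeasurableSpace ((mixedSpace K)ˣ)] [BorelSpace ((mixedSpace K)ˣ)]
      (μ' : Measure ((mixedSpace K)ˣ)) (_ : IsHaarMeasure μ'),
      ∃ (e₀ : archGardingSpace hcpt τ)
        (_ : FiniteDimensional ℂ (Submodule.span ℂ (Set.range
          fun κ : (AutomorphyDatum.gl 2 K hcpt).arch.maximalCompact =>
            τ (toArch hcpt (κ : GL (Fin 2) (mixedSpace K))) (e₀ : E)))) (x₀ x₀' : ℝ),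
        IsGammaProduct x₀ (fun s => ∫ u : (mixedSpace K)ˣ, kirillovFn hτ ℓ e₀ u *
            ((mixedEmbedding.norm ((u : (mixedSpace K)ˣ) : mixedSpace K) : ℝ) : ℂ) ^ (s - 1 / 2) ∂μ') ∧
        IsGammaProduct x₀' (fun s => ∫ u : (mixedSpace K)ˣ,
            ω u⁻¹ * kirillovFn hτ ℓ (gardingAct hτ (weylLong 2 (mixedSpace K)) e₀) u *
              ((mixedEmbedding.norm ((u : (mixedSpace K)ˣ) : mixedSpace K) : ℝ) : ℂ) ^ (s - 1 / 2) ∂μ')) :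
    JacquetLanglands1970_twistedHeckeTheoryGL2 ∧ frobSatakeCompatibleAt_of_isPiOfArtinRep :=
  ⟨JacquetLanglands1970_twistedHeckeTheoryGL2_of_JacquetLanglands1970_standardLTheoryGL2
      (JacquetLanglands1970_standardLTheoryGL2_of_archKirillovGammaProduct hA),
    frobSatakeCompatibleAt_of_isPiOfArtinRep_of_JacquetLanglands1970_standardLTheoryGL2
      (JacquetLanglands1970_standardLTheoryGL2_of_archKirillovGammaProduct hA)⟩

end ArchGammaProduct

end Literature.NumberTheory.Automorphic
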